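import Summits.Ventures.Crystal3D.Theorems.StickyWulffConstantCoaxialWallLawEndRowRootDefs
import Summits.Ventures.Crystal3D.Theorems.StickyWulffConstantCoaxialWallLawEndRowDischarge
import HarnessLib

/-!
# The root-class row: LOCAL ⇒ GLOBAL (the discharge `card_endPairs_le_of_localRootRow`), and the (A)-row companion
# (lane T, crux `TextureLiminfV5`, stmt-Ventures-23912, registered stub `stub_terraceCensus`; cf-p1 RULINGS (ccc)(2)(i) / (ccci))

HONEST FRAMING. Venture `Summits/Ventures/Crystal3D` (cell `crystal3d-full`), route `route-Ventures-StickyWulffConstant`, helper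
`--supports` the law-v5 crux `TextureLiminfV5` (stmt-Ventures-23912), lane T.  Pure finite-sum bookkeeping over lane F's
`card_endPairs_le_of_localRow` (…EndRowDischarge): census-free, certificate-free; nothing about energies; F-C1 not moved.

THE POINT.  Every consumer of a local row (…BarlowOneFccRow, …LevelReachHexagonRow, …LevelReachHexagonPooled) re-derives the same
≈40 lines: the exported pair set `T` injects fibrewise into the multiplicity (`#T_b ≤ mult b`), the exported two-payer clause gives every end
ball a payer within `1`, and the local row at the payers of a window gives `#T ≤ sF · Σ_window (12 − deg)`.  This file packages it once:

* `card_endPairs_le_of_mult_row` — the discharge for an ARBITRARY multiplicity `mult : E3 → ℕ` dominating the fibres of `T`, under the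
  row stated for `mult` at the window's payers;
* `exists_payer_of_hasTwoPayers` — the two-payer clause gives a payer within distance `1`;
* **`card_endPairs_le_of_localRootRow`** — `T` a set of ROOT-CLASS end pairs of `(S₁, S₂)` (`IsEndPairRootA`, …EndRowRootDefs), `PAYW` a
  payer window containing every payer within `1` of an end ball, the root row `LocalEndRowRootA v sF S₁ S₂` BY NAME ⇒
  `#T ≤ sF · Σ_{z ∈ PAYW} (12 − deg z)`; `card_endPairs_le_of_localRootRow_on` — the same with the row assumed only ON `X` at the
  window's payers (for universe-restricted certificates);
* `card_endPairs_le_of_localRowA` / `card_endPairs_le_of_localRowA_on` — the (A)-row companions (`IsEndPairA`, `LocalEndRowA`), the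
  block …LevelReachHexagonPooled inlines.
WHAT THIS IS NOT: not a row (a census fact), not the export; F-C1 not moved.
-/

noncomputable section

namespace Summit.Ventures.Crystal3D.Theorems

open Summit.Ventures.Crystal3D Finset
open scoped InnerProductSpace

variable {X : Finset (EuclideanSpace ℝ (Fin 3))}

open scoped Classical in
/-- **Discharge for an arbitrary dominating multiplicity.**  `T` a finite set of (end ball, mover) pairs with end balls in `X`, `mult`
dominating its fibres, every end ball with a payer within `1`, `PAYW ⊆ {deg ≤ 11}` containing every payer within `1` of an end ball, and the
row for `mult` at every `z ∈ PAYW` ⇒ `#T ≤ sF · Σ_{PAYW} (12 − deg)`. -/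
theorem card_endPairs_le_of_mult_row (T : Finset (EuclideanSpace ℝ (Fin 3) × EuclideanSpace ℝ (Fin 3)))
    (PAYW : Finset (EuclideanSpace ℝ (Fin 3))) {sF : ℝ} (mult : EuclideanSpace ℝ (Fin 3) → ℕ)
    (hT : ∀ bq ∈ T, bq.1 ∈ X)
    (hmult : ∀ b, (T.filter fun bq => bq.1 = b).card ≤ mult b)
    (hPAYW : ∀ z ∈ PAYW, z ∈ X ∧ (X.filter fun q => dist z q = 1).card ≤ 11)
    (hclosed : ∀ bq ∈ T, ∀ z ∈ X, dist bq.1 z ≤ 1 → (X.filter fun q => dist z q = 1).card ≤ 11 → z ∈ PAYW)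
    (hpay : ∀ bq ∈ T, ∃ z ∈ X, dist bq.1 z ≤ 1 ∧ (X.filter fun q => dist z q = 1).card ≤ 11)
    (hrow : ∀ z ∈ PAYW,
      ∑ b ∈ X.filter (fun b => dist z b ≤ 1 ∧ 0 < mult b), (mult b : ℝ) / pooledDef X b ≤ sF) :
    (T.card : ℝ) ≤ sF * ∑ z ∈ PAYW, ((12 : ℝ) - ((X.filter fun q => dist z q = 1).card : ℝ)) := by
  have hDnn : ∀ b, 0 ≤ pooledDef X b := by
    intro b
    refine sum_nonneg fun z hz => ?_
    have : ((X.filter fun q => dist z q = 1).card : ℝ) ≤ 11 := by exact_mod_cast (mem_filter.1 hz).2.2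
    linarith
  have hrow' : ∀ z ∈ PAYW,
      ∑ b ∈ X.filter (fun b => dist z b ≤ 1 ∧ 0 < (T.filter fun bq => bq.1 = b).card),
        ((T.filter fun bq => bq.1 = b).card : ℝ) /
          (∑ z' ∈ X.filter (fun z' => dist b z' ≤ 1 ∧ (X.filter fun q => dist z' q = 1).card ≤ 11),
            ((12 : ℝ) - ((X.filter fun q => dist z' q = 1).card : ℝ))) ≤ sF := by
    intro z hz
    refine le_trans ?_ (hrow z hz)
    calc ∑ b ∈ X.filter (fun b => dist z b ≤ 1 ∧ 0 < (T.filter fun bq => bq.1 = b).card),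
          ((T.filter fun bq => bq.1 = b).card : ℝ) / pooledDef X b
        ≤ ∑ b ∈ X.filter (fun b => dist z b ≤ 1 ∧ 0 < (T.filter fun bq => bq.1 = b).card),
          (mult b : ℝ) / pooledDef X b :=
          sum_le_sum fun b _ => div_le_div_of_nonneg_right (by exact_mod_cast hmult b) (hDnn b)
      _ ≤ ∑ b ∈ X.filter (fun b => dist z b ≤ 1 ∧ 0 < mult b), (mult b : ℝ) / pooledDef X b := by
          refine sum_le_sum_of_subset_of_nonneg (fun b hb => ?_) fun b _ _ => div_nonneg (Nat.cast_nonneg _) (hDnn b)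
          obtain ⟨hbX, hd, hpos⟩ := mem_filter.1 hb
          exact mem_filter.2 ⟨hbX, hd, lt_of_lt_of_le hpos (hmult b)⟩
  exact card_endPairs_le_of_localRow T PAYW hT hPAYW hclosed hpay hrow'

/-- The exported two-payer clause gives a payer within distance `1` of the (occupied) ball `b`. -/
theorem exists_payer_of_hasTwoPayers {b : EuclideanSpace ℝ (Fin 3)} (hb : b ∈ X) (h : HasTwoPayers X b) :
    ∃ z ∈ X, dist b z ≤ 1 ∧ (X.filter fun q => dist z q = 1).card ≤ 11 := by
  rcases h with h11 | ⟨z₁, hz₁, -, -, -, hd₁, -, hc₁, -⟩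
  · exact ⟨b, hb, by rw [dist_self]; norm_num, h11⟩
  · exact ⟨z₁, hz₁, hd₁.le, hc₁⟩

/-! ### The root-class row -/

open scoped Classical in
/-- The fibres of a set of root-class end pairs are dominated by the root-class multiplicity. -/
theorem card_fibre_le_endMultRootA {v : WordVersion} {S₁ S₂ : PlateSystem}
    {T : Finset (EuclideanSpace ℝ (Fin 3) × EuclideanSpace ℝ (Fin 3))} (hEP : ∀ bq ∈ T, IsEndPairRootA X v S₁ S₂ bq.1 bq.2)
    (b : EuclideanSpace ℝ (Fin 3)) : (T.filter fun bq => bq.1 = b).card ≤ endMultRootA X v S₁ S₂ b := by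
  unfold endMultRootA
  refine card_le_card_of_injOn (fun bq => bq.2) (fun bq hbq => ?_) ?_
  · obtain ⟨hbqT, hb1⟩ := mem_filter.1 hbq
    have hep := hEP bq hbqT
    rw [hb1] at hep
    have hq : bq.2 ∈ X := by
      rcases hep with h | h
      · exact h.1
      · exact h.1
    exact mem_coe.2 (mem_filter.2 ⟨hq, hep⟩)
  · intro bq hbq bq' hbq' heq
    obtain ⟨-, hb⟩ := mem_filter.1 (mem_coe.1 hbq)
    obtain ⟨-, hb'⟩ := mem_filter.1 (mem_coe.1 hbq')
    exact Prod.ext (hb.trans hb'.symm) heq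

open scoped Classical in
/-- **Root-class local row ⇒ global end-pair bound, row assumed only ON `X`.**  `T` a set of root-class end pairs of `(S₁, S₂)`
(`IsEndPairRootA`), `PAYW ⊆ {z ∈ X : deg z ≤ 11}` containing every payer within `1` of an end ball, and the root-class row inequality at
every `z ∈ PAYW` for THIS configuration ⇒ `#T ≤ sF · Σ_{PAYW} (12 − deg)`. -/
theorem card_endPairs_le_of_localRootRow_on (v : WordVersion) (S₁ S₂ : PlateSystem)
    (T : Finset (EuclideanSpace ℝ (Fin 3) × EuclideanSpace ℝ (Fin 3))) (PAYW : Finset (EuclideanSpace ℝ (Fin 3))) {sF : ℝ}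
    (hEP : ∀ bq ∈ T, IsEndPairRootA X v S₁ S₂ bq.1 bq.2)
    (hPAYW : ∀ z ∈ PAYW, z ∈ X ∧ (X.filter fun q => dist z q = 1).card ≤ 11)
    (hclosed : ∀ bq ∈ T, ∀ z ∈ X, dist bq.1 z ≤ 1 → (X.filter fun q => dist z q = 1).card ≤ 11 → z ∈ PAYW)
    (hrow : ∀ z ∈ PAYW,
      ∑ b ∈ X.filter (fun b => dist z b ≤ 1 ∧ 0 < endMultRootA X v S₁ S₂ b),
        (endMultRootA X v S₁ S₂ b : ℝ) / pooledDef X b ≤ sF) :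
    (T.card : ℝ) ≤ sF * ∑ z ∈ PAYW, ((12 : ℝ) - ((X.filter fun q => dist z q = 1).card : ℝ)) := by
  have hTb : ∀ bq ∈ T, bq.1 ∈ X ∧ HasTwoPayers X bq.1 := by
    intro bq hbq
    rcases hEP bq hbq with h | h
    · exact ⟨h.2.1, h.2.2.1⟩
    · exact ⟨h.2.1, h.2.2.1⟩
  exact card_endPairs_le_of_mult_row T PAYW (endMultRootA X v S₁ S₂) (fun bq hbq => (hTb bq hbq).1)
    (card_fibre_le_endMultRootA hEP) hPAYW hclosed
    (fun bq hbq => exists_payer_of_hasTwoPayers (hTb bq hbq).1 (hTb bq hbq).2) hrow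

open scoped Classical in
/-- **Root-class local row ⇒ global end-pair bound (the row BY NAME).**  As `card_endPairs_le_of_localRootRow_on`, with the row
`LocalEndRowRootA v sF S₁ S₂` for all configurations and `X` `1`-separated. -/
theorem card_endPairs_le_of_localRootRow (hX : ∀ p ∈ X, ∀ q ∈ X, p ≠ q → 1 ≤ dist p q) (v : WordVersion) (S₁ S₂ : PlateSystem)
    (T : Finset (EuclideanSpace ℝ (Fin 3) × EuclideanSpace ℝ (Fin 3))) (PAYW : Finset (EuclideanSpace ℝ (Fin 3))) {sF : ℝ}
    (hEP : ∀ bq ∈ T, IsEndPairRootA X v S₁ S₂ bq.1 bq.2)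
    (hPAYW : ∀ z ∈ PAYW, z ∈ X ∧ (X.filter fun q => dist z q = 1).card ≤ 11)
    (hclosed : ∀ bq ∈ T, ∀ z ∈ X, dist bq.1 z ≤ 1 → (X.filter fun q => dist z q = 1).card ≤ 11 → z ∈ PAYW)
    (hrow : LocalEndRowRootA v sF S₁ S₂) :
    (T.card : ℝ) ≤ sF * ∑ z ∈ PAYW, ((12 : ℝ) - ((X.filter fun q => dist z q = 1).card : ℝ)) :=
  card_endPairs_le_of_localRootRow_on v S₁ S₂ T PAYW hEP hPAYW hclosed
    fun z hz => hrow X hX z (hPAYW z hz).1 (hPAYW z hz).2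

/-! ### The (A)-row companion -/

open scoped Classical in
/-- The fibres of a set of (A)-end pairs are dominated by the (A) multiplicity. -/
theorem card_fibre_le_endMultA {v : WordVersion} {S₁ S₂ : PlateSystem}
    {T : Finset (EuclideanSpace ℝ (Fin 3) × EuclideanSpace ℝ (Fin 3))} (hEP : ∀ bq ∈ T, IsEndPairA X v S₁ S₂ bq.1 bq.2)
    (b : EuclideanSpace ℝ (Fin 3)) : (T.filter fun bq => bq.1 = b).card ≤ endMultA X v S₁ S₂ b := by
  unfold endMultA
  refine card_le_card_of_injOn (fun bq => bq.2) (fun bq hbq => ?_) ?_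
  · obtain ⟨hbqT, hb1⟩ := mem_filter.1 hbq
    have hep := hEP bq hbqT
    rw [hb1] at hep
    exact mem_coe.2 (mem_filter.2 ⟨hep.1, hep⟩)
  · intro bq hbq bq' hbq' heq
    obtain ⟨-, hb⟩ := mem_filter.1 (mem_coe.1 hbq)
    obtain ⟨-, hb'⟩ := mem_filter.1 (mem_coe.1 hbq')
    exact Prod.ext (hb.trans hb'.symm) heq

open scoped Classical in
/-- **(A) local row ⇒ global end-pair bound, row assumed only ON `X`.** -/
theorem card_endPairs_le_of_localRowA_on (v : WordVersion) (S₁ S₂ : PlateSystem)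
    (T : Finset (EuclideanSpace ℝ (Fin 3) × EuclideanSpace ℝ (Fin 3))) (PAYW : Finset (EuclideanSpace ℝ (Fin 3))) {sF : ℝ}
    (hEP : ∀ bq ∈ T, IsEndPairA X v S₁ S₂ bq.1 bq.2)
    (hPAYW : ∀ z ∈ PAYW, z ∈ X ∧ (X.filter fun q => dist z q = 1).card ≤ 11)
    (hclosed : ∀ bq ∈ T, ∀ z ∈ X, dist bq.1 z ≤ 1 → (X.filter fun q => dist z q = 1).card ≤ 11 → z ∈ PAYW)
    (hrow : ∀ z ∈ PAYW,
      ∑ b ∈ X.filter (fun b => dist z b ≤ 1 ∧ 0 < endMultA X v S₁ S₂ b),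
        (endMultA X v S₁ S₂ b : ℝ) / pooledDef X b ≤ sF) :
    (T.card : ℝ) ≤ sF * ∑ z ∈ PAYW, ((12 : ℝ) - ((X.filter fun q => dist z q = 1).card : ℝ)) :=
  card_endPairs_le_of_mult_row T PAYW (endMultA X v S₁ S₂) (fun bq hbq => (hEP bq hbq).2.1)
    (card_fibre_le_endMultA hEP) hPAYW hclosed
    (fun bq hbq => exists_payer_of_hasTwoPayers (hEP bq hbq).2.1 (hEP bq hbq).2.2.1) hrow

open scoped Classical in
/-- **(A) local row ⇒ global end-pair bound (the row BY NAME).** -/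
theorem card_endPairs_le_of_localRowA (hX : ∀ p ∈ X, ∀ q ∈ X, p ≠ q → 1 ≤ dist p q) (v : WordVersion) (S₁ S₂ : PlateSystem)
    (T : Finset (EuclideanSpace ℝ (Fin 3) × EuclideanSpace ℝ (Fin 3))) (PAYW : Finset (EuclideanSpace ℝ (Fin 3))) {sF : ℝ}
    (hEP : ∀ bq ∈ T, IsEndPairA X v S₁ S₂ bq.1 bq.2)
    (hPAYW : ∀ z ∈ PAYW, z ∈ X ∧ (X.filter fun q => dist z q = 1).card ≤ 11)
    (hclosed : ∀ bq ∈ T, ∀ z ∈ X, dist bq.1 z ≤ 1 → (X.filter fun q => dist z q = 1).card ≤ 11 → z ∈ PAYW)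
    (hrow : LocalEndRowA v sF S₁ S₂) :
    (T.card : ℝ) ≤ sF * ∑ z ∈ PAYW, ((12 : ℝ) - ((X.filter fun q => dist z q = 1).card : ℝ)) :=
  card_endPairs_le_of_localRowA_on v S₁ S₂ T PAYW hEP hPAYW hclosed
    fun z hz => hrow X hX z (hPAYW z hz).1 (hPAYW z hz).2

end Summit.Ventures.Crystal3D.Theorems

end
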